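import Summits.ABC.StewartYu.DescentStepThirdQ
import Summits.ABC.StewartYu.DescentIntegralityQ
import HarnessLib

/-!
# Cell abc-stewartyu, W80Two (ix): integrality of the signed cores of the TRIADIC descent, and the
# raw size of the `Δ`-factor at scale `3^{J₀−J}` — sign-free

`Summits/ABC/StewartYu/DescentIntegralityThirdQ.lean` — cell `abc-stewartyu` (HOME
`run/shared/lean/pub/abc-stewartyu/`, seat p2; route `PadicPrimesW80TwoThirds`, crux `W80Two`
stmt-ABC-19486), sequel to `DescentStepThirdQ.lean`; one definition (`Dclear3`) and theorems, no
named fact.  The base-`3` twin of p3's `DescentIntegralityQ.lean` / the tree's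
`Waldschmidt1980.DclearJ` bookkeeping, RECORD-FREE (no parameter system): these are the `hint`/`hDc`/
`Dc` inputs of `TwoSetup.siegel3_of_count`, `KSizes3` and `thirdStep_of_numerics`.

* `box3_subset_box` — the box of level `J` of the triadic descent lies in the dyadic box of the same
  level (`Lⱼ/3ᴶ ≤ Lⱼ/2ᴶ`), so every landed per-unknown bound stated under `u ∈ box L Lθ J` applies;
* `exists_int_nu_pow_mul_DwQ` — `ν(h)ᵏ · DwQ c a b h k s ∈ ℤ` at natural points, for ANY scale `c`
  (`Waldschmidt1980.nuIntegral_wScaled`; `ν = Waldschmidt1980.nu h`, POINT-INDEPENDENT, `log ν ≤ 6h`),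
  `exists_int_nu_pow_mul_qΔ3`;
* `Dclear3 J L Lθ s τ := ν(h)^{τ₀} · |b_θ|^{|τ'|} · (∏ⱼ den αⱼ^{⌊Lⱼ/3ᴶ⌋ s}) · den θ^{⌊L_θ/3ᴶ⌋ s}` — one
  clearing denominator for level `J` (no `J₀`: `ν` does not see the point), `Dclear3_pos`;
* **`exists_int_Dclear3_mul_qTerm3`** (`u ∈ box3 L Lθ J`), `exists_int_Dclear3_mul_coreSum3`;
* `exists_int_den_pow_mul_qEt`, **`exists_int_Dclear3_mul_thirdWeight`** — the SAME `Dclear3 J` clears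
  the third-point weights `(qΔ3_{J₀,J+1}(u;τ₀,s) · qA♭(u,τ')) · qEt(u,s)` on the box of level `J`
  (`⌊expnᵢ/3⌋ ≤ ⌊Lᵢ/3ᴶ⌋ s`);
* `card_box3`, `box3_zero_eq_box_zero`, `card_box3_le_card_box(_3_zero)` — counting the boxes;
* `abs_DwQ_le`, `abs_qΔ3_le` — the raw archimedean size
  `|DwQ c a b h k s| ≤ k! · cᵏ · 2^{a+bh} · (e (c s + h)/h)^{h(b+1)}` (the tree's
  `CW77.norm_hasseDeriv_wPoly_eval_le_exp` at the point `c s`), to be compared with the record's `𝔅`.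

Everything is [folklore] bookkeeping on [Waldschmidt1980, Lemma 3.4] / [Yu1989, §3].

## References
* [Waldschmidt1980] M. Waldschmidt, Acta Arith. 37 (1980), Lemma 2.4 (p. 261–262), Lemma 3.4 (p. 269).
* [Yu1989] K. Yu, Acta Arith. 53 (1989), §3.
* [BakerTNT1975] A. Baker, *Transcendental Number Theory*, Ch. 3 §2 Lemma 1.
-/

noncomputable section

open Finset Polynomial
open Literature.NumberTheory.Transcendental
open Literature.NumberTheory.Transcendental.CW77
open Literature.NumberTheory.Transcendental.CW77.Setup (Idx Tau tauNorm)
open Literature.NumberTheory.Transcendental.PadicCW77.Setup (DwQ)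
open Literature.NumberTheory.Transcendental.Waldschmidt1980 (wScaled wPolyQ nu nu_pos nuIntegral_wScaled)
open Literature.NumberTheory.Transcendental.Baker1975.Ch3 (wPoly)

namespace Summit.ABC.StewartYu

/-! ### Integrality and size of the scale-generic value factor `DwQ` -/

/-- **`ν(h)ᵏ · DwQ c a b h k s ∈ ℤ`** at a natural point `s`, for any scale `c` (`a ≤ h`):
`DwQ = k! · ((1/k!) dᵏ w(cX))(s)` and `w(cX)` is `ν(h)`-integral. [cite: Waldschmidt1980, (3.18) p. 266] -/
theorem exists_int_nu_pow_mul_DwQ {a h : ℕ} (hah : a ≤ h) (c b k s : ℕ) :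
    ∃ z : ℤ, ((nu h : ℚ) ^ k) * DwQ c a b h k (s : ℚ) = z := by
  obtain ⟨z, hz⟩ := nuIntegral_wScaled hah c (b := b) k s
  refine ⟨k.factorial * z, ?_⟩
  unfold PadicCW77.Setup.DwQ
  rw [Waldschmidt1980.iterate_derivative_eval_eq_factorial_mul_hasseDeriv_eval]
  push_cast
  rw [← hz]
  ring

/-- **The raw archimedean size of the value factor**: for `a < h`,
`|DwQ c a b h k s| ≤ k! · cᵏ · (2^{a+bh} · (e (c s + h)/h)^{h(b+1)})` (the tree's
`Waldschmidt1980.norm_pv_le`, i.e. `CW77.norm_hasseDeriv_wPoly_eval_le_exp` at the natural point `c s`).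
[cite: Waldschmidt1980, (3.17) p. 266] [cite: BakerTNT1975, Ch. 3 §2 Lemma 1] -/
theorem abs_DwQ_le {a h : ℕ} (hah : a < h) (c b k s : ℕ) :
    |(DwQ c a b h k (s : ℚ) : ℝ)| ≤ k.factorial * (c : ℝ) ^ k *
      (2 ^ (a + b * h) * (Real.exp 1 * ((c * s : ℕ) + h) / h) ^ (h * (b + 1))) := by
  have hh : 1 ≤ h := by omega
  set ab : Fin h × Fin (b + 1) := (⟨a, hah⟩, ⟨b, Nat.lt_succ_self b⟩) with hab
  -- `DwQ … s` is the rational value factor `pvQ`, whose complex avatar `pv` the tree bounds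
  have hpvQ : Waldschmidt1980.pvQ c ab k (s : ℚ) = DwQ c a b h k (s : ℚ) := rfl
  have hnorm : |(DwQ c a b h k (s : ℚ) : ℝ)| = ‖Waldschmidt1980.pv c ab k ((s : ℚ) : ℂ)‖ := by
    rw [Waldschmidt1980.pv_ratCast, hpvQ, Complex.norm_ratCast]
  rw [hnorm]
  have hb := Waldschmidt1980.norm_pv_le hh c ab k ((s : ℚ) : ℂ)
  have hceil : ⌈(c : ℝ) * ‖((s : ℚ) : ℂ)‖⌉₊ = c * s := by
    rw [show ((s : ℚ) : ℂ) = (s : ℂ) by push_cast; rfl, Complex.norm_natCast, ← Nat.cast_mul,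
      Nat.ceil_natCast]
  rw [hceil] at hb
  simpa only [hab] using hb

namespace SetupQ

variable (Q : SetupQ) {h Lb : ℕ}

/-! ### The triadic box inside the dyadic box -/

/-- `⌊L/3ᴶ⌋ ≤ ⌊L/2ᴶ⌋`. [folklore] -/
theorem div_three_pow_le_div_two_pow (L' J : ℕ) : L' / 3 ^ J ≤ L' / 2 ^ J :=
  Nat.div_le_div_left (Nat.pow_le_pow_left (by norm_num) J) (Nat.pow_pos (by norm_num))

/-- **The box of level `J` of the triadic descent lies in the dyadic box of the same level**, so the
landed per-unknown size bounds stated under `u ∈ box L Lθ J` apply on `box3 L Lθ J`. [folklore] -/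
theorem box3_subset_box (L : Fin Q.d → ℕ) (Lθ J : ℕ) :
    Q.box3 (h := h) (Lb := Lb) L Lθ J ⊆ Q.flat.box (h := h) (Lb := Lb) L Lθ J := by
  intro u hu
  rw [Q.mem_box3] at hu
  rw [Q.flat.mem_box]
  exact ⟨fun j => (hu.1 j).trans (div_three_pow_le_div_two_pow _ _),
    hu.2.trans (div_three_pow_le_div_two_pow _ _)⟩

/-- `box3 L Lθ J ⊆ box3 L Lθ 0` (= all `λⱼ ≤ Lⱼ`, `λ_θ ≤ L_θ`). [folklore] -/
theorem box3_subset_box3_zero (L : Fin Q.d → ℕ) (Lθ J : ℕ) :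
    Q.box3 (h := h) (Lb := Lb) L Lθ J ⊆ Q.box3 (h := h) (Lb := Lb) L Lθ 0 := by
  intro u hu
  rw [Q.mem_box3] at hu ⊢
  simp only [pow_zero, Nat.div_one]
  exact ⟨fun j => (hu.1 j).trans (Nat.div_le_self _ _), hu.2.trans (Nat.div_le_self _ _)⟩

/-! ### Integrality of the `Δ`-factor -/

/-- **`ν(h)^{τ₀} · qΔ3_{J₀,J}(u; τ₀, s) ∈ ℤ`** (`r < h`). [cite: Waldschmidt1980, (3.18) p. 266] -/
theorem exists_int_nu_pow_mul_qΔ3 (J₀ J : ℕ) (u : Idx Q.d h Lb) (τ₀ s : ℕ) :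
    ∃ z : ℤ, ((nu h : ℚ) ^ τ₀) * Q.qΔ3 J₀ J u τ₀ s = z :=
  exists_int_nu_pow_mul_DwQ (le_of_lt u.1.1.isLt) _ _ _ _

/-- **The raw size of the triadic `Δ`-factor**: `|qΔ3_{J₀,J}(u;τ₀,s)| ≤ τ₀!·(3^{J₀−J})^{τ₀}·2^{r+lh}·
(e(3^{J₀−J}s + h)/h)^{h(l+1)}`. [cite: Waldschmidt1980, (3.17) p. 266] -/
theorem abs_qΔ3_le (J₀ J : ℕ) (u : Idx Q.d h Lb) (τ₀ s : ℕ) :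
    |(Q.qΔ3 J₀ J u τ₀ s : ℝ)| ≤ τ₀.factorial * ((3 ^ (J₀ - J) : ℕ) : ℝ) ^ τ₀ *
      (2 ^ ((u.1.1 : ℕ) + (u.1.2 : ℕ) * h) *
        (Real.exp 1 * ((3 ^ (J₀ - J) * s : ℕ) + h) / h) ^ (h * ((u.1.2 : ℕ) + 1))) :=
  abs_DwQ_le u.1.1.isLt _ _ _ _

/-! ### The clearing denominator of level `J` -/

/-- **The clearing denominator of the triadic level `J`**:
`Dclear3_J(s,τ) = ν(h)^{τ₀} · |b_θ|^{|τ'|} · ∏ⱼ den(αⱼ)^{⌊Lⱼ/3ᴶ⌋ s} · den(θ)^{⌊L_θ/3ᴶ⌋ s}` — it clears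
`qTerm3_{J}(u,τ,s)` for `u` in the box of level `J`, and also the third-point weights of level `J`
(below). [cite: Waldschmidt1980, Lemma 3.4 (p. 269)] -/
def Dclear3 (J : ℕ) (L : Fin Q.d → ℕ) (Lθ : ℕ) (s : ℕ) (τ : Tau Q.d) : ℕ :=
  nu h ^ τ.1 * Q.bθ.natAbs ^ (∑ j, τ.2 j) *
    ((∏ j, (Q.α j).den ^ (L j / 3 ^ J * s)) * Q.θ.den ^ (Lθ / 3 ^ J * s))

/-- `Dclear3 > 0`. [folklore] -/
theorem Dclear3_pos (J : ℕ) (L : Fin Q.d → ℕ) (Lθ : ℕ) (s : ℕ) (τ : Tau Q.d) :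
    0 < Q.Dclear3 (h := h) J L Lθ s τ := by
  unfold Dclear3
  refine Nat.mul_pos (Nat.mul_pos (Nat.pow_pos (nu_pos _)) (Nat.pow_pos ?_))
    (Nat.mul_pos ?_ (Nat.pow_pos Q.θ.pos))
  · exact Int.natAbs_pos.mpr Q.bθ_ne
  · exact prod_pos fun j _ => Nat.pow_pos (Q.α j).pos

/-- `|b_θ|^{|τ'|} · qA♭(u,τ') ∈ ℤ` (the flattening has the same `b`, `b_θ`). [folklore] -/
theorem exists_int_natAbs_pow_mul_qA (u : Idx Q.d h Lb) (τ' : Fin Q.d → ℕ) :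
    ∃ z : ℤ, ((Q.bθ.natAbs ^ (∑ j, τ' j) : ℕ) : ℚ) * Q.flat.qA u τ' = z :=
  Q.flat.exists_int_qA u τ'

/-- **`Dclear3_J(s,τ) · qTerm3_{J₀,J}(u,τ,s) ∈ ℤ` on the box of level `J`.**
[cite: Waldschmidt1980, Lemma 3.4 (p. 269)] -/
theorem exists_int_Dclear3_mul_qTerm3 (J₀ J : ℕ) {L : Fin Q.d → ℕ} {Lθ : ℕ} {u : Idx Q.d h Lb}
    (hu : u ∈ Q.box3 (h := h) (Lb := Lb) L Lθ J) (τ : Tau Q.d) (s : ℕ) :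
    ∃ z : ℤ, ((Q.Dclear3 (h := h) J L Lθ s τ : ℕ) : ℚ) * Q.qTerm3 J₀ J u τ s = z := by
  rw [Q.mem_box3] at hu
  obtain ⟨z₁, hz₁⟩ := Q.exists_int_nu_pow_mul_qΔ3 J₀ J u τ.1 s
  obtain ⟨z₂, hz₂⟩ := Q.exists_int_natAbs_pow_mul_qA u τ.2
  obtain ⟨z₃, hz₃⟩ := Q.exists_int_qE (L := fun j => L j / 3 ^ J) (Lθ := Lθ / 3 ^ J) hu s
  refine ⟨z₁ * z₂ * z₃, ?_⟩
  unfold Dclear3 qTerm3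
  push_cast at hz₁ hz₂ hz₃ ⊢
  rw [← hz₁, ← hz₂, ← hz₃]; ring

/-- **`Dclear3_J(s,τ) · coreSum3_{J₀,J}(τ,s) ∈ ℤ`** for integer coefficients supported anywhere (the sum
runs over the box of level `J`). [folklore] -/
theorem exists_int_Dclear3_mul_coreSum3 (J₀ J : ℕ) (L : Fin Q.d → ℕ) (Lθ : ℕ)
    (p : Idx Q.d h Lb → ℤ) (τ : Tau Q.d) (s : ℕ) :
    ∃ z : ℤ, ((Q.Dclear3 (h := h) J L Lθ s τ : ℕ) : ℚ) *
      Q.coreSum3 J₀ J (Q.box3 (h := h) (Lb := Lb) L Lθ J) p τ s = z := by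
  classical
  unfold coreSum3
  rw [mul_sum]
  have hterm : ∀ u ∈ Q.box3 (h := h) (Lb := Lb) L Lθ J,
      ∃ z : ℤ, ((Q.Dclear3 (h := h) J L Lθ s τ : ℕ) : ℚ) * ((p u : ℚ) * Q.qTerm3 J₀ J u τ s) = z := by
    intro u hu
    obtain ⟨z, hz⟩ := Q.exists_int_Dclear3_mul_qTerm3 J₀ J hu τ s
    exact ⟨p u * z, by push_cast; rw [← hz]; ring⟩
  choose! z hz using hterm
  refine ⟨∑ u ∈ Q.box3 (h := h) (Lb := Lb) L Lθ J, z u, ?_⟩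
  push_cast
  exact sum_congr rfl fun u hu => hz u hu

/-! ### Integrality at the third points -/

/-- `(∏ den αⱼ^{⌊Lⱼ/3ᴶ⌋ s}) den θ^{⌊L_θ/3ᴶ⌋ s} · qEt(u,s) ∈ ℤ` on the box of level `J`
(`⌊expnᵢ/3⌋ ≤ expnᵢ ≤ ⌊Lᵢ/3ᴶ⌋ s`). [folklore] -/
theorem exists_int_den_pow_mul_qEt {L : Fin Q.d → ℕ} {Lθ J : ℕ} {u : Idx Q.d h Lb}
    (hu : u ∈ Q.box3 (h := h) (Lb := Lb) L Lθ J) (s : ℕ) :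
    ∃ z : ℤ, (((∏ j, (Q.α j).den ^ (L j / 3 ^ J * s)) * Q.θ.den ^ (Lθ / 3 ^ J * s) : ℕ) : ℚ) *
      Q.qEt u s = z := by
  rw [Q.mem_box3] at hu
  have hone : ∀ (q : ℚ) (e Lq : ℕ), e ≤ Lq * s → ∃ z : ℤ, ((q.den ^ (Lq * s) : ℕ) : ℚ) * q ^ e = z := by
    intro q e Lq hle
    refine ⟨(q.den : ℤ) ^ (Lq * s - e) * q.num ^ e, ?_⟩
    have hsplit : Lq * s = (Lq * s - e) + e := (Nat.sub_add_cancel hle).symm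
    rw [hsplit, pow_add]
    push_cast
    rw [mul_assoc, ← mul_pow, Rat.den_mul_eq_num]
    congr 2; omega
  have hlam : ∀ j, Q.flat.expn u s (Fin.castSucc j) / 3 ≤ L j / 3 ^ J * s := by
    intro j
    rw [Q.flat_expn_castSucc]
    calc u.2.1 j * s / 3 ≤ u.2.1 j * s := Nat.div_le_self _ _
      _ ≤ L j / 3 ^ J * s := Nat.mul_le_mul_right _ (hu.1 j)
  have hθ' : Q.flat.expn u s (Fin.last Q.d) / 3 ≤ Lθ / 3 ^ J * s := by
    rw [Q.flat_expn_last]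
    calc u.2.2 * s / 3 ≤ u.2.2 * s := Nat.div_le_self _ _
      _ ≤ Lθ / 3 ^ J * s := Nat.mul_le_mul_right _ hu.2
  choose zα hzα using fun j => hone (Q.α j) _ (L j / 3 ^ J) (hlam j)
  obtain ⟨zθ, hzθ⟩ := hone Q.θ _ (Lθ / 3 ^ J) hθ'
  refine ⟨(∏ j, zα j) * zθ, ?_⟩
  unfold qEt
  rw [Fin.prod_univ_castSucc]
  unfold all
  simp only [Fin.snoc_castSucc, Fin.snoc_last]
  have hα' : ∏ j, ((((Q.α j).den : ℚ)) ^ (L j / 3 ^ J * s) * (Q.α j) ^ (Q.flat.expn u s (Fin.castSucc j) / 3)) =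
      ∏ j, (zα j : ℚ) :=
    prod_congr rfl fun j _ => by exact_mod_cast hzα j
  push_cast at hzθ ⊢
  calc (∏ j, (((Q.α j).den : ℚ)) ^ (L j / 3 ^ J * s)) * ((Q.θ.den : ℚ)) ^ (Lθ / 3 ^ J * s) *
        ((∏ j, Q.α j ^ (Q.flat.expn u s (Fin.castSucc j) / 3)) * Q.θ ^ (Q.flat.expn u s (Fin.last Q.d) / 3))
      = (∏ j, ((((Q.α j).den : ℚ)) ^ (L j / 3 ^ J * s) * (Q.α j) ^ (Q.flat.expn u s (Fin.castSucc j) / 3))) *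
          (((Q.θ.den : ℚ)) ^ (Lθ / 3 ^ J * s) * Q.θ ^ (Q.flat.expn u s (Fin.last Q.d) / 3)) := by
        rw [prod_mul_distrib]; ring
    _ = (∏ j, (zα j : ℚ)) * (zθ : ℚ) := by rw [hα', hzθ]

/-- **`Dclear3_J(s,τ)` clears the third-point weights of level `J`**:
`Dclear3_J(s,τ) · ((qΔ3_{J₀,J+1}(u;τ₀,s) · qA♭(u,τ')) · qEt(u,s)) ∈ ℤ` for `u` in the box of level `J`
— the `hDc` input of `TwoSetup.thirdStep_of_numerics` with `D(s,τ) := Dclear3_J(s,τ)`.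
[cite: Yu1989, §3] [cite: Waldschmidt1980, Lemma 3.4 (p. 269)] -/
theorem exists_int_Dclear3_mul_thirdWeight (J₀ J : ℕ) {L : Fin Q.d → ℕ} {Lθ : ℕ} {u : Idx Q.d h Lb}
    (hu : u ∈ Q.box3 (h := h) (Lb := Lb) L Lθ J) (τ : Tau Q.d) (s : ℕ) :
    ∃ z : ℤ, ((Q.Dclear3 (h := h) J L Lθ s τ : ℕ) : ℚ) *
      ((Q.qΔ3 J₀ (J + 1) u τ.1 s * Q.flat.qA u τ.2) * Q.qEt u s) = z := by
  obtain ⟨z₁, hz₁⟩ := Q.exists_int_nu_pow_mul_qΔ3 J₀ (J + 1) u τ.1 s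
  obtain ⟨z₂, hz₂⟩ := Q.exists_int_natAbs_pow_mul_qA u τ.2
  obtain ⟨z₃, hz₃⟩ := Q.exists_int_den_pow_mul_qEt hu s
  refine ⟨z₁ * z₂ * z₃, ?_⟩
  unfold Dclear3
  push_cast at hz₁ hz₂ hz₃ ⊢
  rw [← hz₁, ← hz₂, ← hz₃]; ring

/-- The denominator as a real product (for the record's size estimates). [folklore] -/
theorem cast_Dclear3 (J : ℕ) (L : Fin Q.d → ℕ) (Lθ : ℕ) (s : ℕ) (τ : Tau Q.d) :
    ((Q.Dclear3 (h := h) J L Lθ s τ : ℕ) : ℝ) =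
      (nu h : ℝ) ^ τ.1 * (Q.bθ.natAbs : ℝ) ^ (∑ j, τ.2 j) *
        ((∏ j, ((Q.α j).den : ℝ) ^ (L j / 3 ^ J * s)) * (Q.θ.den : ℝ) ^ (Lθ / 3 ^ J * s)) := by
  unfold Dclear3; push_cast; ring

/-! ### Counting the box of level `J` -/

/-- **The cardinality of the box of level `J` of the triadic descent**:
`#box3_J = h · Lb · ∏ⱼ (⌊Lⱼ/3ᴶ⌋ + 1) · (⌊L_θ/3ᴶ⌋ + 1)`. [folklore] -/
theorem card_box3 (L : Fin Q.d → ℕ) (Lθ J : ℕ) :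
    (Q.box3 (h := h) (Lb := Lb) L Lθ J).card = h * Lb * ((∏ j, (L j / 3 ^ J + 1)) * (Lθ / 3 ^ J + 1)) := by
  unfold box3
  rw [card_product, card_product, card_univ, Fintype.card_prod, Fintype.card_fin, Fintype.card_fin,
    Fintype.card_piFinset, card_range]
  simp only [card_range]

/-- At level `0` the triadic and the dyadic boxes coincide (all `λⱼ ≤ Lⱼ`, `λ_θ ≤ L_θ`), so the
landed level-`0` Siegel counts and coefficient bounds apply verbatim. [folklore] -/
theorem box3_zero_eq_box_zero (L : Fin Q.d → ℕ) (Lθ : ℕ) :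
    Q.box3 (h := h) (Lb := Lb) L Lθ 0 = Q.flat.box (h := h) (Lb := Lb) L Lθ 0 := by
  ext u
  rw [Q.mem_box3, Q.flat.mem_box]
  simp only [pow_zero, Nat.div_one]

/-- `#box3_J ≤ #box_J` (the triadic box lies in the dyadic one). [folklore] -/
theorem card_box3_le_card_box (L : Fin Q.d → ℕ) (Lθ J : ℕ) :
    (Q.box3 (h := h) (Lb := Lb) L Lθ J).card ≤ (Q.flat.box (h := h) (Lb := Lb) L Lθ J).card :=
  card_le_card (Q.box3_subset_box L Lθ J)

/-- `#box3_J ≤ #box3₀`. [folklore] -/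
theorem card_box3_le_card_box3_zero (L : Fin Q.d → ℕ) (Lθ J : ℕ) :
    (Q.box3 (h := h) (Lb := Lb) L Lθ J).card ≤ (Q.box3 (h := h) (Lb := Lb) L Lθ 0).card :=
  card_le_card (Q.box3_subset_box3_zero L Lθ J)

end SetupQ

end Summit.ABC.StewartYu

end
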